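/-
Copyright (c) 2026. All rights reserved.
Released under Apache 2.0 license as described in the file LICENSE.
-/
import Summits.AtomisticToContinuum.Crystallization.Theorems.OverbindingBudgetAffineFarStraighteningCompat
import Summits.AtomisticToContinuum.Crystallization.Theorems.OverbindingBudgetAffineFarStraighteningExtCert

/-!
# Overbinding budget — R_aff′ brick EXT: a two-point isometric snap extends to the whole common shell or misses it by `≥ 1/3`

Slot Z of `stmt-AtomisticToContinuum-31280`, leaf `…FarSmoothSplit.AffineChartStraightening'` (R_aff′), radial development (g59
memo §3).  In the development the exact relabelling of a new adjacency `(e ∈ P, f ∈ P')` is DEFINED on the basis `(f, c₁, c₂)`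
(`c₁, c₂` an independent pair of the common shell of `f`, `exists_goodPair`) by the label bijection, and `snapRigidity_pair` makes it a
linear isometry `U`.  **EXT** (`snapExtension_holds`): for every other common neighbour `c'` of `f` and every common neighbour `p` of
`e`, `dist (U c' + e) p < 1/3 → U c' + e = p`.  So the approximate label agreement of the remaining two shared sites (accuracy `O(ε)`)
upgrades `U` to a full `IsSnap`, after which COMPAT (`snapCompatibility_holds`) applies.  (This and `snapRigidity_pair` replace brick R0
`LabelAffineConsistency` of the g59 design memo.)

Proof: the integer certificate `…StraighteningExtCert` (48 kernel `decide`s; exact enumeration `g59/compat/ext_cert2.py`: 2304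
two-point isometric snaps, 1368 extend fully, the minimal nonzero squared distance of an image `U c' + e` to the common shell of `e` is
`2/9`; `fcc ← fcc` always extends) + the transport of COMPAT: `16N' c' = 8N' f + B₁(2c₁ − f) + B₂(2c₂ − f)` (certified coordinatewise) gives
`16N'(U c' + e) = 8N' e + B₁(2d₁ − e) + B₂(2d₂ − e) =: q ∈ ℤ³` and `dist (U c' + e, p)² = ‖q − 16N' p‖²_ℤ / (256 N'² N)`.
-/

namespace Summit.AtomisticToContinuum.Crystallization.Theorems.OverbindingBudgetAffineFarSmoothSplit

open scoped BigOperators RealInnerProductSpace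
open Literature.Geometry.DiscreteGeometry (fccTwoShellPattern hcpTwoShellPattern scaledPattern intVec intVec_apply intVec_sub
  norm_intVec sqNormInt fccInt hcpInt fccSecondShellInt hcpSecondShellInt sqNormInt_fccInt sqNormInt_hcpInt)

/-! ## §1  The brick -/

/-- **EXT · SNAP EXTENSION.**  For a linear isometry `U` with `U f = −e` mapping an independent pair `c₁, c₂` of the common shell of
`f` into the common shell of `e` (translated by `−e`), the image `U c' + e` of any common neighbour `c'` of `f` either IS a common
neighbour `p` of `e` or is `≥ 1/3` away from it. [this file; g59 memo §3] -/
def SnapExtension : Prop :=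
  ∀ (P P' : Finset (EuclideanSpace ℝ (Fin 3))), (P = fccTwoShellPattern ∨ P = hcpTwoShellPattern) →
    (P' = fccTwoShellPattern ∨ P' = hcpTwoShellPattern) → ∀ e ∈ P, ‖e‖ = 1 → ∀ f ∈ P', ‖f‖ = 1 →
      ∀ c₁ c₂, InCommonShell P' f c₁ → InCommonShell P' f c₂ → (⟪c₁, c₂⟫ = 1 / 2 ∨ ⟪c₁, c₂⟫ = 0) →
        ∀ (U : EuclideanSpace ℝ (Fin 3) →ₗᵢ[ℝ] EuclideanSpace ℝ (Fin 3)), U f = -e →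
          InCommonShell P e (U c₁ + e) → InCommonShell P e (U c₂ + e) →
            ∀ c', InCommonShell P' f c' → ∀ p, InCommonShell P e p → dist (U c' + e) p < 1 / 3 → U c' + e = p

/-! ## §2  Transport and the proof -/

/-- Inner product `1/2` (resp. `0`) of two scaled integer vectors, as an integer identity. [this file] -/
theorem goodPair_int_of_inner {N : ℕ} (hN : N ≠ 0) {a b : Fin 3 → ℤ}
    (h : ⟪(Real.sqrt N)⁻¹ • intVec a, (Real.sqrt N)⁻¹ • intVec b⟫ = 1 / 2 ∨
      ⟪(Real.sqrt N)⁻¹ • intVec a, (Real.sqrt N)⁻¹ • intVec b⟫ = 0) :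
    2 * dotInt a b = (N : ℤ) ∨ dotInt a b = 0 := by
  have hNpos : (0 : ℝ) < (N : ℝ) := by exact_mod_cast Nat.pos_of_ne_zero hN
  have hsN : ((Real.sqrt N)⁻¹) ^ 2 = (N : ℝ)⁻¹ := by rw [inv_pow, Real.sq_sqrt hNpos.le]
  have hN0 : (N : ℝ) ≠ 0 := hNpos.ne'
  rw [inner_scaled_scaled, hsN] at h
  rcases h with h | h
  · left
    have h2 : 2 * (dotInt a b : ℝ) = (N : ℝ) := by
      field_simp at h
      linarith
    exact_mod_cast h2
  · right
    have h2 : (dotInt a b : ℝ) = 0 := by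
      rcases mul_eq_zero.1 h with h | h
      · exact absurd h (inv_ne_zero hN0)
      · exact h
    exact_mod_cast h2

/-- **EXT on the integer models.** [this file] -/
theorem snapExt_scaled {S S₂ S' S₂' : Finset (Fin 3 → ℤ)} {N N' : ℕ} (hN : N ≠ 0) (hN' : N' ≠ 0)
    (hfirst : ∀ z ∈ S ∪ S₂, sqNormInt z = N → z ∈ S) (hfirst' : ∀ z ∈ S' ∪ S₂', sqNormInt z = N' → z ∈ S')
    (hcert : ∀ zf ∈ S', SnapExtAt S N S' N' zf)
    {e f c₁ c₂ : EuclideanSpace ℝ (Fin 3)} (he : e ∈ scaledPattern (S ∪ S₂) N) (he1 : ‖e‖ = 1)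
    (hf : f ∈ scaledPattern (S' ∪ S₂') N') (hf1 : ‖f‖ = 1)
    (hc₁ : InCommonShell (scaledPattern (S' ∪ S₂') N') f c₁) (hc₂ : InCommonShell (scaledPattern (S' ∪ S₂') N') f c₂)
    (hpair : ⟪c₁, c₂⟫ = 1 / 2 ∨ ⟪c₁, c₂⟫ = 0)
    (U : EuclideanSpace ℝ (Fin 3) →ₗᵢ[ℝ] EuclideanSpace ℝ (Fin 3)) (hUf : U f = -e)
    (hd₁ : InCommonShell (scaledPattern (S ∪ S₂) N) e (U c₁ + e)) (hd₂ : InCommonShell (scaledPattern (S ∪ S₂) N) e (U c₂ + e))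
    {c' p : EuclideanSpace ℝ (Fin 3)} (hc' : InCommonShell (scaledPattern (S' ∪ S₂') N') f c')
    (hp : InCommonShell (scaledPattern (S ∪ S₂) N) e p) (hlt : dist (U c' + e) p < 1 / 3) : U c' + e = p := by
  have hNpos : (0 : ℝ) < (N : ℝ) := by exact_mod_cast Nat.pos_of_ne_zero hN
  have hN'pos : (0 : ℝ) < (N' : ℝ) := by exact_mod_cast Nat.pos_of_ne_zero hN'
  have hN0 : (N : ℝ) ≠ 0 := hNpos.ne'
  have hN'0 : (N' : ℝ) ≠ 0 := hN'pos.ne'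
  have hsN : ((Real.sqrt N)⁻¹) ^ 2 = (N : ℝ)⁻¹ := by rw [inv_pow, Real.sq_sqrt hNpos.le]
  obtain ⟨ze, hze, rfl⟩ := Finset.mem_image.1 he
  have hzeS : ze ∈ S := hfirst ze hze (sqNormInt_eq_of_norm_scaled_eq_one hN he1)
  obtain ⟨zf, hzf, rfl⟩ := Finset.mem_image.1 hf
  have hzfS : zf ∈ S' := hfirst' zf hzf (sqNormInt_eq_of_norm_scaled_eq_one hN' hf1)
  -- inner products with `f` are `1/2`
  have hhalf : ∀ c, InCommonShell (scaledPattern (S' ∪ S₂') N') ((Real.sqrt N')⁻¹ • intVec zf) c →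
      ⟪c, (Real.sqrt N')⁻¹ • intVec zf⟫ = 1 / 2 := fun c hc => real_inner_eq_half hc.2.1 hf1 hc.2.2
  have hC₁f := hhalf _ hc₁
  have hC₂f := hhalf _ hc₂
  have hC'f := hhalf _ hc'
  -- integer representatives
  obtain ⟨zc₁, hzc₁S, rfl, hc₁f⟩ := exists_int_of_inCommonShell hN' hfirst' hc₁
  obtain ⟨zc₂, hzc₂S, rfl, hc₂f⟩ := exists_int_of_inCommonShell hN' hfirst' hc₂
  obtain ⟨zc', hzc'S, rfl, hc'f⟩ := exists_int_of_inCommonShell hN' hfirst' hc'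
  obtain ⟨zp, hzpS, rfl, hpe⟩ := exists_int_of_inCommonShell hN hfirst hp
  obtain ⟨zd₁, hzd₁S, hd₁eq, hd₁e⟩ := exists_int_of_inCommonShell hN hfirst hd₁
  obtain ⟨zd₂, hzd₂S, hd₂eq, hd₂e⟩ := exists_int_of_inCommonShell hN hfirst hd₂
  have hgood : 2 * dotInt zc₁ zc₂ = (N' : ℤ) ∨ dotInt zc₁ zc₂ = 0 := goodPair_int_of_inner hN' hpair
  have hgram : (N' : ℤ) * dotInt zd₁ zd₂ = N * dotInt zc₁ zc₂ := by
    apply int_eq_of_inner_scaled_eq hN hN'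
    rw [← hd₁eq, ← hd₂eq, inner_snapImage U hUf he1 hC₁f hC₂f]
  have hmem : ∀ {T : Finset (Fin 3 → ℤ)} {M : ℕ} {a b : Fin 3 → ℤ}, a ∈ T → sqNormInt (a - b) = M → a ∈ adjInt T M b :=
    fun ha hab => Finset.mem_filter.2 ⟨ha, hab⟩
  obtain ⟨hdecs, hpairs⟩ := hcert zf hzfS zc₁ (hmem hzc₁S hc₁f) zc₂ (hmem hzc₂S hc₂f) hgood
  have hdec := hdecs zc' (hmem hzc'S hc'f)
  have hpair' := hpairs ze hzeS zd₁ (hmem hzd₁S hd₁e) zd₂ (hmem hzd₂S hd₂e) hgram zc' (hmem hzc'S hc'f) zp (hmem hzpS hpe)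
  -- the decomposition of `c'`, realised, and its image
  have hUc₁ : U ((Real.sqrt N')⁻¹ • intVec zc₁) = (Real.sqrt N)⁻¹ • intVec zd₁ - (Real.sqrt N)⁻¹ • intVec ze := by
    rw [← hd₁eq, add_sub_cancel_right]
  have hUc₂ : U ((Real.sqrt N')⁻¹ • intVec zc₂) = (Real.sqrt N)⁻¹ • intVec zd₂ - (Real.sqrt N)⁻¹ • intVec ze := by
    rw [← hd₂eq, add_sub_cancel_right]
  have hdecR : (16 * (N' : ℝ)) • ((Real.sqrt N')⁻¹ • intVec zc') =
      (8 * (N' : ℝ)) • ((Real.sqrt N')⁻¹ • intVec zf) +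
        (extB N' zc₁ zc₂ zc' : ℝ) • ((2 : ℝ) • ((Real.sqrt N')⁻¹ • intVec zc₁) - (Real.sqrt N')⁻¹ • intVec zf) +
        (extB N' zc₂ zc₁ zc' : ℝ) • ((2 : ℝ) • ((Real.sqrt N')⁻¹ • intVec zc₂) - (Real.sqrt N')⁻¹ • intVec zf) := by
    ext i
    have hi : ((16 * (N' : ℤ) * zc' i : ℤ) : ℝ) = ((8 * (N' : ℤ) * zf i + extB N' zc₁ zc₂ zc' * (2 * zc₁ i - zf i) +
        extB N' zc₂ zc₁ zc' * (2 * zc₂ i - zf i) : ℤ) : ℝ) := by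
      exact_mod_cast hdec i
    push_cast at hi
    simp only [PiLp.add_apply, PiLp.sub_apply, PiLp.smul_apply, smul_eq_mul, intVec_apply]
    linear_combination (Real.sqrt N')⁻¹ * hi
  have hq : (Real.sqrt N)⁻¹ • intVec (extQ N' ze zd₁ zd₂ zc₁ zc₂ zc') =
      (8 * (N' : ℝ)) • ((Real.sqrt N)⁻¹ • intVec ze) +
        (extB N' zc₁ zc₂ zc' : ℝ) • ((2 : ℝ) • ((Real.sqrt N)⁻¹ • intVec zd₁) - (Real.sqrt N)⁻¹ • intVec ze) +
        (extB N' zc₂ zc₁ zc' : ℝ) • ((2 : ℝ) • ((Real.sqrt N)⁻¹ • intVec zd₂) - (Real.sqrt N)⁻¹ • intVec ze) := by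
    ext i
    simp only [PiLp.add_apply, PiLp.sub_apply, PiLp.smul_apply, smul_eq_mul, intVec_apply, extQ]
    push_cast
    ring
  have h16 : (16 * (N' : ℝ)) ≠ 0 := by positivity
  have himage : (16 * (N' : ℝ)) • (U ((Real.sqrt N')⁻¹ • intVec zc') + (Real.sqrt N)⁻¹ • intVec ze) =
      (Real.sqrt N)⁻¹ • intVec (extQ N' ze zd₁ zd₂ zc₁ zc₂ zc') := by
    rw [hq, smul_add, ← LinearIsometry.map_smul, hdecR]
    simp only [map_add, map_sub, LinearIsometry.map_smul, hUf, hUc₁, hUc₂]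
    module
  have hdiff : U ((Real.sqrt N')⁻¹ • intVec zc') + (Real.sqrt N)⁻¹ • intVec ze - (Real.sqrt N)⁻¹ • intVec zp =
      ((Real.sqrt N)⁻¹ * (16 * (N' : ℝ))⁻¹) • intVec (fun i => extQ N' ze zd₁ zd₂ zc₁ zc₂ zc' i - 16 * N' * zp i) := by
    have h1 : U ((Real.sqrt N')⁻¹ • intVec zc') + (Real.sqrt N)⁻¹ • intVec ze =
        (16 * (N' : ℝ))⁻¹ • ((Real.sqrt N)⁻¹ • intVec (extQ N' ze zd₁ zd₂ zc₁ zc₂ zc')) := by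
      rw [← himage, smul_smul, inv_mul_cancel₀ h16, one_smul]
    rw [h1]
    ext i
    simp only [PiLp.sub_apply, PiLp.smul_apply, smul_eq_mul, intVec_apply]
    push_cast
    field_simp
  have hd2 : dist (U ((Real.sqrt N')⁻¹ • intVec zc') + (Real.sqrt N)⁻¹ • intVec ze) ((Real.sqrt N)⁻¹ • intVec zp) ^ 2 =
      (sqNormInt (fun i => extQ N' ze zd₁ zd₂ zc₁ zc₂ zc' i - 16 * N' * zp i) : ℝ) / (256 * (N' : ℝ) ^ 2 * N) := by
    rw [dist_eq_norm, hdiff, norm_smul, norm_intVec, mul_pow, Real.sq_sqrt (show (0 : ℝ) ≤ (sqNormInt _ : ℝ) by unfold sqNormInt; push_cast; positivity),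
      Real.norm_of_nonneg (by positivity), mul_pow, hsN]
    field_simp
    ring
  rcases hpair' with hzero | hbig
  · have h0 : intVec (fun i => extQ N' ze zd₁ zd₂ zc₁ zc₂ zc' i - 16 * N' * zp i) = 0 := by
      ext i; simp [intVec, hzero i]
    have : U ((Real.sqrt N')⁻¹ • intVec zc') + (Real.sqrt N)⁻¹ • intVec ze - (Real.sqrt N)⁻¹ • intVec zp = 0 := by
      rw [hdiff, h0, smul_zero]
    exact sub_eq_zero.1 this
  · exfalso
    have hbigR : (256 * (N' : ℝ) ^ 2 * N : ℝ) ≤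
        9 * (sqNormInt (fun i => extQ N' ze zd₁ zd₂ zc₁ zc₂ zc' i - 16 * N' * zp i) : ℝ) := by
      exact_mod_cast hbig
    have h1 : (1 / 9 : ℝ) ≤ dist (U ((Real.sqrt N')⁻¹ • intVec zc') + (Real.sqrt N)⁻¹ • intVec ze)
        ((Real.sqrt N)⁻¹ • intVec zp) ^ 2 := by
      rw [hd2, le_div_iff₀ (by positivity)]
      linarith
    have h0 := dist_nonneg (x := U ((Real.sqrt N')⁻¹ • intVec zc') + (Real.sqrt N)⁻¹ • intVec ze)
      (y := (Real.sqrt N)⁻¹ • intVec zp)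
    nlinarith

/-- **EXT · SNAP EXTENSION holds.** [this file; g59 memo §3] -/
theorem snapExtension_holds : SnapExtension := by
  intro P P' hP hP' e he he1 f hf hf1 c₁ c₂ hc₁ hc₂ hpair U hUf hd₁ hd₂ c' hc' p hp hlt
  rcases hP with rfl | rfl <;> rcases hP' with rfl | rfl
  · exact snapExt_scaled two_ne_zero two_ne_zero (by exact_mod_cast mem_fccInt_of_sqNormInt)
      (by exact_mod_cast mem_fccInt_of_sqNormInt) (by exact_mod_cast snapExtAt_fcc_fcc) he he1 hf hf1 hc₁ hc₂ hpair U hUf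
      hd₁ hd₂ hc' hp hlt
  · exact snapExt_scaled two_ne_zero (by norm_num) (by exact_mod_cast mem_fccInt_of_sqNormInt)
      (by exact_mod_cast mem_hcpInt_of_sqNormInt) (by exact_mod_cast snapExtAt_fcc_hcp) he he1 hf hf1 hc₁ hc₂ hpair U hUf
      hd₁ hd₂ hc' hp hlt
  · exact snapExt_scaled (by norm_num) two_ne_zero (by exact_mod_cast mem_hcpInt_of_sqNormInt)
      (by exact_mod_cast mem_fccInt_of_sqNormInt) (by exact_mod_cast snapExtAt_hcp_fcc) he he1 hf hf1 hc₁ hc₂ hpair U hUf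
      hd₁ hd₂ hc' hp hlt
  · exact snapExt_scaled (by norm_num) (by norm_num) (by exact_mod_cast mem_hcpInt_of_sqNormInt)
      (by exact_mod_cast mem_hcpInt_of_sqNormInt) (by exact_mod_cast snapExtAt_hcp_hcp) he he1 hf hf1 hc₁ hc₂ hpair U hUf
      hd₁ hd₂ hc' hp hlt

end Summit.AtomisticToContinuum.Crystallization.Theorems.OverbindingBudgetAffineFarSmoothSplit
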